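import Literature.NumberTheory.Automorphic.IdeleClassCharacterAutConjSelfDual
import HarnessLib

/-!
# The CM type of the `Gal(ℂ/ℚ)`-conjugate of a conjugate symplectic automorphic character,
# `Φ_{σμ} = σΦ_μ`, and the group law `σ(τμ) = (στ)μ` ([Liu21] Def. 4.3, Cor. 4.20)

Topic `NumberTheory/Automorphic`; namespace `Literature.NumberTheory.Automorphic` (grouping sub-namespace
`IdeleClassGroup`).  **Theorems only: no definition, no named fact, no `sorry`** (D-0026).  Sequel of
`IdeleClassCharacterAutConj` (`IdeleClassGroup.autConj σ ψ e he hodd = σμ`, the unitary character with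
`(σμ)^{alg} = ^σ(μ^{alg})`, its unitary ∞-type `e^σ = q' − p'`, `hasInfinityType_autConj`, `odd_autConjExp`) and of
`IdeleClassCharacterAutConjSelfDual` (`IsConjugateSymplectic.isConjugateSymplectic_autConj`: `σμ` is again
conjugate symplectic, so that its CM type `(…).cmType` of [Liu21] Def. 4.3 is defined); that file lists
"`Φ_{σμ} = σ ∘ Φ_μ`" as NOT HERE (i) — it is proved here.

SOURCE.  Y. Liu, *Fourier–Jacobi cycles and arithmetic relative trace formula*, Camb. J. Math. **9** (2021)
= arXiv:2102.11518 [Liu2021], TeX source `FJcycle.tex`; held extraction `paper:arxiv-2102.11518` p0018, p0023.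

AS PRINTED.  Remark 4.2 (ll. 1909–1913): "there exist a CM type `Φ_μ` … such that for every `τ ∈ Φ_F`, the
component `μ_τ` … is the character `z ↦ arg(z)^{−𝔴_τ}`, where we have identified `(E ⊗_{F,τ} ℝ)^×` with `ℂ^×`
via the unique element `τ' ∈ Φ_μ` above `τ`."  Def. 4.3 (2) (l. 1918–1921): "we call `Φ_μ` the *CM type* of `μ`.
Furthermore, we denote by `M'_μ ⊆ ℂ` the reflex field of `(E, Φ_μ)`".  Cor. 4.20 (l. 2307): "representatives
of `Gal(ℂ/ℚ)`-orbits of all conjugate symplectic automorphic characters … of weight one".  For the conjugate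
`σμ` (`(σμ)^{alg} = ^σ(μ^{alg})`, Weil 1956) the component at `τ` read through `σ ∘ τ'` is again
`arg(z)^{−𝔴}`: `Φ_{σμ} = σΦ_μ ≔ {σ ∘ τ' : τ' ∈ Φ_μ}` (and so `M'_{σμ} = σ(M'_μ)`, matching `M_{σμ} = σ(M_μ)`).

WHAT IS HERE (`L` a CM field, `ψ : C_L →ₜ* S¹`, `σ : ℂ ≃ₐ[ℚ] ℂ`; the tree reads ∞-types through
`exponentAt e φ` — `e_w` in the coordinate `σ_w = w.embedding`, `−e_w` in `σ̄_w` — and CM types through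
`cmTypeOf e = {φ | exponentAt e φ < 0}`, `ConjugateSelfDualCharacters`).
* **`exponentAt_autConjExp`** — `exponentAt e^σ φ = exponentAt e (σ⁻¹ ∘ φ)` for every embedding `φ : L → ℂ`:
  the exponents of the conjugate type `^σ(p, q)` are `n^σ_φ = n_{σ⁻¹∘φ}` (`HeckeCharacter.embExponent_autConjType`),
  `n_{φ̄} − n_φ = exponentAt e φ` for `(p, q) = ((1−e)/2, (1+e)/2)`, and on a CM field
  `σ⁻¹ ∘ φ̄ = \\overline{σ⁻¹ ∘ φ}` (Mathlib `IsCMField.complexEmbedding_complexConj`).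
* `mem_cmTypeOf_autConjExp_iff` — hence `φ ∈ cmTypeOf e^σ ↔ σ⁻¹ ∘ φ ∈ cmTypeOf e`.
* **`IsConjugateSymplectic.mem_cmType_autConj_iff`** — **`Φ_{σμ} = σΦ_μ`**: for conjugate symplectic `μ`,
  `φ ∈ Φ_{σμ} ↔ σ⁻¹ ∘ φ ∈ Φ_μ`, with `Φ_{σμ}` the CM type (`IsConjugateSymplectic.cmType`, Def. 4.3) of the
  conjugate symplectic character `σμ`.

* **the group law** `autConj_autConj : σ(τμ) = (στ)μ` (general odd ∞-type), `IsConjugateSymplectic.autConj_autConj`,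
  `IsConjugateSymplectic.autConj_one`, `IsConjugateSymplectic.autConj_symm_autConj` (`σ⁻¹(σμ) = μ`): the conjugates
  `{σμ : σ ∈ Aut(ℂ)}` form literally ONE `Aut(ℂ)`-orbit, through each of its members (Cor. 4.20's "orbits").

NOT HERE.  The reflex-field consequence `M'_{σμ} = σ(M'_μ)` as a `traceField` identity (immediate from the
membership statement; no consumer); "`d(μ,K)` depends only on the orbit" (representation theory; CITE).

## References

* [Liu2021] Y. Liu, *Fourier–Jacobi cycles and arithmetic relative trace formula*, Camb. J. Math. 9 (2021),
  no. 1, 1–147, arXiv:2102.11518 — Remark 4.2, Def. 4.3 (TeX ll. 1909–1921), Cor. 4.20 (l. 2307).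
* [Weil1956] A. Weil, *On a certain type of characters of the idèle-class group of an algebraic number-field*
  (1956), §1 (the type of `^σχ`).
-/

set_option autoImplicit false

noncomputable section

open scoped ComplexConjugate
open NumberField IsDedekindDomain NumberField.InfinitePlace

namespace Literature.NumberTheory.Automorphic

open GaloisRepresentations

namespace IdeleClassGroup

/-! ## The ∞-type and the CM type of `σμ` through `σ`: `e^σ(φ) = e(σ⁻¹ ∘ φ)`, `Φ_{σμ} = σΦ_μ` -/

section CMTypeTransport

variable {L : Type} [Field L] [NumberField L] [IsCMField L]

/-- On a CM field, post-composition with an automorphism of `ℂ` commutes with the conjugation of embeddings: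
`τ ∘ φ̄ = \overline{τ ∘ φ}` (every embedding intertwines the complex conjugation of `L` with that of `ℂ`,
Mathlib `IsCMField.complexEmbedding_complexConj`). [folklore] -/
private theorem comp_conjugate_eq_conjugate_comp (τ : ℂ ≃ₐ[ℚ] ℂ) (φ : L →+* ℂ) :
    (τ : ℂ ≃ₐ[ℚ] ℂ).toAlgHom.toRingHom.comp (ComplexEmbedding.conjugate φ) =
      ComplexEmbedding.conjugate ((τ : ℂ ≃ₐ[ℚ] ℂ).toAlgHom.toRingHom.comp φ) := by
  refine RingHom.ext fun x => ?_
  change τ (conj (φ x)) = conj (τ (φ x))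
  rw [← NumberField.IsCMField.complexEmbedding_complexConj L φ x]
  exact NumberField.IsCMField.complexEmbedding_complexConj L ((τ : ℂ ≃ₐ[ℚ] ℂ).toAlgHom.toRingHom.comp φ) x

omit [NumberField L] [IsCMField L] in
/-- The exponents of the algebraic type `((1−e)/2, (1+e)/2)` recover the unitary exponent:
`n_{φ̄} − n_φ = exponentAt e φ` (`= e_w` in the coordinate `σ_w`, `−e_w` in `σ̄_w`). [folklore] -/
private theorem embExponent_conjugate_sub_embExponent [IsTotallyComplex L] (e : InfinitePlace L → ℤ)
    (hodd : ∀ w, Odd (e w)) (χ : L →+* ℂ) :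
    HeckeCharacter.embExponent (fun w => (1 - e w) / 2) (fun w => (1 + e w) / 2) (ComplexEmbedding.conjugate χ) -
      HeckeCharacter.embExponent (fun w => (1 - e w) / 2) (fun w => (1 + e w) / 2) χ = exponentAt e χ := by
  have hχ : ¬ ComplexEmbedding.IsReal χ := not_isReal_of_mk_isComplex (IsTotallyComplex.isComplex _)
  have hχ' : ¬ ComplexEmbedding.IsReal (ComplexEmbedding.conjugate χ) := by
    rwa [ComplexEmbedding.isReal_conjugate_iff]
  have hne : ComplexEmbedding.conjugate χ ≠ χ := fun h => hχ (ComplexEmbedding.isReal_iff.2 h)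
  obtain ⟨k, hk⟩ := hodd (InfinitePlace.mk χ)
  unfold HeckeCharacter.embExponent exponentAt
  rw [if_neg hχ, if_neg hχ', mk_conjugate_eq]
  rcases embedding_mk_eq χ with h | h
  · have h1 : ¬ ComplexEmbedding.conjugate χ = (InfinitePlace.mk χ).embedding := fun h' => hne (h'.trans h)
    rw [if_neg h1, if_pos h.symm, if_pos h]
    dsimp only
    rw [hk]
    omega
  · have h1 : ¬ χ = (InfinitePlace.mk χ).embedding := fun h' => hne (h.symm.trans h'.symm)
    rw [if_pos h.symm, if_neg h1, if_neg (fun h' => h1 h'.symm)]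
    dsimp only
    rw [hk]
    omega

/-- The exponent of `σμ` at a distinguished embedding `σ_w`. [folklore] -/
private theorem exponentAt_autConjExp_embedding (σ : ℂ ≃ₐ[ℚ] ℂ) {e : InfinitePlace L → ℤ}
    (hodd : ∀ w, Odd (e w)) (w : InfinitePlace L) :
    exponentAt (fun w =>
        (HeckeCharacter.autConjType σ (fun w => (1 - e w) / 2) (fun w => (1 + e w) / 2)).2 w -
          (HeckeCharacter.autConjType σ (fun w => (1 - e w) / 2) (fun w => (1 + e w) / 2)).1 w) w.embedding =
      exponentAt e (((σ.symm : ℂ ≃ₐ[ℚ] ℂ)).toAlgHom.toRingHom.comp w.embedding) := by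
  rw [exponentAt_embedding]
  have h1 : (HeckeCharacter.autConjType σ (fun w => (1 - e w) / 2) (fun w => (1 + e w) / 2)).1 w =
      HeckeCharacter.embExponent (fun w => (1 - e w) / 2) (fun w => (1 + e w) / 2)
        (((σ.symm : ℂ ≃ₐ[ℚ] ℂ)).toAlgHom.toRingHom.comp w.embedding) := rfl
  have h2 : (HeckeCharacter.autConjType σ (fun w => (1 - e w) / 2) (fun w => (1 + e w) / 2)).2 w =
      HeckeCharacter.embExponent (fun w => (1 - e w) / 2) (fun w => (1 + e w) / 2)
        (((σ.symm : ℂ ≃ₐ[ℚ] ℂ)).toAlgHom.toRingHom.comp (ComplexEmbedding.conjugate w.embedding)) := by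
    unfold HeckeCharacter.autConjType HeckeCharacter.typeOfExponent
    dsimp only
    rw [if_neg (not_isReal_iff_isComplex.2 (IsTotallyComplex.isComplex w))]
  simp only [h1, h2]
  rw [comp_conjugate_eq_conjugate_comp, embExponent_conjugate_sub_embExponent e hodd]

/-- **The ∞-type of `σμ` through `σ`: `exponentAt e^σ φ = exponentAt e (σ⁻¹ ∘ φ)`** for every embedding
`φ : L → ℂ` of the CM field `L` — the unitary exponent of `σμ` in the coordinate `φ` is that of `μ` in the
coordinate `σ⁻¹ ∘ φ` (the type of `^σ(μ^{alg})` has exponents `n^σ_φ = n_{σ⁻¹∘φ}`,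
`HeckeCharacter.embExponent_autConjType`, and `σ⁻¹ ∘ φ̄ = \overline{σ⁻¹ ∘ φ}` on a CM field).  In Liu's
notation: `μ_τ = arg^{-𝔴_τ}` through `τ' ∈ Φ_μ` becomes `(σμ)_τ = arg^{-𝔴}` through `σ ∘ τ'`.
[cite: Liu2021, Remark 4.2 and Cor. 4.20 (TeX ll. 1909–1913, 2307)] [cite: Weil1956, §1] -/
theorem exponentAt_autConjExp (σ : ℂ ≃ₐ[ℚ] ℂ) {e : InfinitePlace L → ℤ} (hodd : ∀ w, Odd (e w))
    (φ : L →+* ℂ) :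
    exponentAt (fun w =>
        (HeckeCharacter.autConjType σ (fun w => (1 - e w) / 2) (fun w => (1 + e w) / 2)).2 w -
          (HeckeCharacter.autConjType σ (fun w => (1 - e w) / 2) (fun w => (1 + e w) / 2)).1 w) φ =
      exponentAt e (((σ.symm : ℂ ≃ₐ[ℚ] ℂ)).toAlgHom.toRingHom.comp φ) := by
  have hφ : ¬ ComplexEmbedding.IsReal φ := not_isReal_of_mk_isComplex (IsTotallyComplex.isComplex _)
  rcases embedding_mk_eq φ with h | h
  · rw [← h]
    exact exponentAt_autConjExp_embedding σ hodd _
  · have hφ' : φ = ComplexEmbedding.conjugate (InfinitePlace.mk φ).embedding := by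
      rw [h, ComplexEmbedding.involutive_conjugate L φ]
    have hχ : ¬ ComplexEmbedding.IsReal (((σ.symm : ℂ ≃ₐ[ℚ] ℂ)).toAlgHom.toRingHom.comp
        (InfinitePlace.mk φ).embedding) := not_isReal_of_mk_isComplex (IsTotallyComplex.isComplex _)
    rw [hφ', exponentAt_conjugate _ (not_isReal_of_mk_isComplex (IsTotallyComplex.isComplex _)),
      exponentAt_autConjExp_embedding σ hodd, comp_conjugate_eq_conjugate_comp, exponentAt_conjugate _ hχ]

/-- **`Φ_{σμ} = σΦ_μ` at the level of `cmTypeOf`**: for odd `e`, an embedding `φ` lies in the CM type of the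
conjugate ∞-type `e^σ` iff `σ⁻¹ ∘ φ` lies in the CM type of `e`. [cite: Liu2021, Def. 4.3 and Cor. 4.20 (TeX ll. 1915–1921, 2307)] -/
theorem mem_cmTypeOf_autConjExp_iff (σ : ℂ ≃ₐ[ℚ] ℂ) {e : InfinitePlace L → ℤ} (hodd : ∀ w, Odd (e w))
    (he0 : ∀ w, e w ≠ 0)
    (he0' : ∀ w, (HeckeCharacter.autConjType σ (fun w => (1 - e w) / 2) (fun w => (1 + e w) / 2)).2 w -
      (HeckeCharacter.autConjType σ (fun w => (1 - e w) / 2) (fun w => (1 + e w) / 2)).1 w ≠ 0)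
    (φ : L →+* ℂ) :
    φ ∈ (cmTypeOf L (fun w =>
        (HeckeCharacter.autConjType σ (fun w => (1 - e w) / 2) (fun w => (1 + e w) / 2)).2 w -
          (HeckeCharacter.autConjType σ (fun w => (1 - e w) / 2) (fun w => (1 + e w) / 2)).1 w) he0').1 ↔
      ((σ.symm : ℂ ≃ₐ[ℚ] ℂ)).toAlgHom.toRingHom.comp φ ∈ (cmTypeOf L e he0).1 := by
  rw [mem_cmTypeOf_iff, mem_cmTypeOf_iff, exponentAt_autConjExp σ hodd]

variable {ψ : IdeleClassGroup L →ₜ* Circle}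

/-- **[Liu21]: the CM type of the conjugate, `Φ_{σμ} = σΦ_μ`.**  For a conjugate symplectic `μ` and
`σ ∈ Aut(ℂ)`, an embedding `φ : E → ℂ` lies in the CM type `Φ_{σμ}` of the (conjugate symplectic,
`isConjugateSymplectic_autConj`) character `σμ` iff `σ⁻¹ ∘ φ ∈ Φ_μ` — i.e. `Φ_{σμ} = {σ ∘ τ' : τ' ∈ Φ_μ}`.
(So `M'_{σμ} = σ(M'_μ)` for the reflex fields, matching `M_{σμ} = σ(M_μ)` of `muAlgValueField_autConj`.)
[cite: Liu2021, Def. 4.3 and Cor. 4.20 (TeX ll. 1915–1921, 2307)] -/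
theorem IsConjugateSymplectic.mem_cmType_autConj_iff (hψ : IsConjugateSymplectic L ψ) (σ : ℂ ≃ₐ[ℚ] ℂ)
    (φ : L →+* ℂ) :
    φ ∈ ((hψ.isConjugateSymplectic_autConj σ).cmType).1 ↔
      ((σ.symm : ℂ ≃ₐ[ℚ] ℂ)).toAlgHom.toRingHom.comp φ ∈ (hψ.cmType).1 := by
  have hodd : ∀ w, Odd (hψ.infinityType w) := fun w => hψ.odd hψ.hasInfinityType_infinityType w
  have he0' : ∀ w, (HeckeCharacter.autConjType σ (fun w => (1 - hψ.infinityType w) / 2)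
      (fun w => (1 + hψ.infinityType w) / 2)).2 w -
      (HeckeCharacter.autConjType σ (fun w => (1 - hψ.infinityType w) / 2)
        (fun w => (1 + hψ.infinityType w) / 2)).1 w ≠ 0 := by
    intro w h0
    obtain ⟨k, hk⟩ := odd_autConjExp σ hψ.hasInfinityType_infinityType hodd w
    omega
  have hΦ' : (hψ.isConjugateSymplectic_autConj σ).cmType = cmTypeOf L _ he0' :=
    (hψ.isConjugateSymplectic_autConj σ).cmType_eq
      (hasCMType_cmTypeOf (hasInfinityType_autConj σ hψ.hasInfinityType_infinityType hodd) he0')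
  rw [hΦ', mem_cmTypeOf_autConjExp_iff σ hodd hψ.infinityType_ne_zero he0' φ]
  rfl

end CMTypeTransport

/-! ## The group law `σ(τμ) = (στ)μ`: the conjugates form ONE `Aut(ℂ)`-orbit -/

section GroupLaw

variable {L : Type} [Field L] [NumberField L]

/-- `autConj` does not depend on the chosen ∞-type datum: two ∞-types of the same character coincide
(`hasInfinityType_unique`, totally complex `L`). [folklore] -/
private theorem autConj_congr [IsTotallyComplex L] (σ : ℂ ≃ₐ[ℚ] ℂ) {ψ : IdeleClassGroup L →ₜ* Circle}
    {e e' : InfinitePlace L → ℤ} (he : HasInfinityType L ψ e) (hodd : ∀ w, Odd (e w))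
    (he' : HasInfinityType L ψ e') (hodd' : ∀ w, Odd (e' w)) :
    autConj σ ψ e he hodd = autConj σ ψ e' he' hodd' := by
  obtain rfl : e = e' := funext fun w => infinityType_unique_of_isComplex L ψ he he' (IsTotallyComplex.isComplex w)
  rfl

/-- **The group law `σ(τμ) = (στ)μ`** for the conjugates of a unitary character of odd ∞-type: conjugating
`τμ` (∞-type `e^τ`, `hasInfinityType_autConj`, again odd, `odd_autConjExp`) by `σ` gives `(στ)μ` — both have
algebraic twist `x ↦ σ(τ(μ^{alg}(x)))` on the finite ideles, which determine a character of `C_L`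
(`IdeleClassGroup.eq_of_eqOn_finiteIdeles`).  So `{σμ : σ ∈ Aut(ℂ)}` is literally one `Aut(ℂ)`-orbit (Cor. 4.20:
"`Gal(ℂ/ℚ)`-orbits of … characters"). [cite: Liu2021, Cor. 4.20 (TeX ll. 2307–2314)] [cite: Weil1956, §1] -/
theorem autConj_autConj [IsTotallyComplex L] (σ τ : ℂ ≃ₐ[ℚ] ℂ) {ψ : IdeleClassGroup L →ₜ* Circle}
    {e : InfinitePlace L → ℤ} (he : HasInfinityType L ψ e) (hodd : ∀ w, Odd (e w)) :
    autConj σ (autConj τ ψ e he hodd) _ (hasInfinityType_autConj τ he hodd) (odd_autConjExp τ he hodd) =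
      autConj (σ * τ) ψ e he hodd := by
  refine eq_of_eqOn_finiteIdeles L _ _ fun x hx => ?_
  apply Circle.ext
  rw [mk_apply, coe_autConj_apply_mk_of_fst_eq_one σ _ _ hx, coe_muAlg_autConj_apply_of_fst_eq_one τ he hodd hx,
    coe_autConj_apply_mk_of_fst_eq_one (σ * τ) he hodd hx, AlgEquiv.mul_apply]

variable [IsCMField L] {ψ : IdeleClassGroup L →ₜ* Circle}

/-- **The group law for conjugate symplectic `μ`: `σ(τμ) = (στ)μ`**, with `τμ` conjugated through its own
canonical ∞-type (`IsConjugateSymplectic.autConj` of the conjugate symplectic character `τμ`,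
`isConjugateSymplectic_autConj`). [cite: Liu2021, Cor. 4.20 (TeX ll. 2307–2314)] -/
theorem IsConjugateSymplectic.autConj_autConj (hψ : IsConjugateSymplectic L ψ) (σ τ : ℂ ≃ₐ[ℚ] ℂ) :
    (hψ.isConjugateSymplectic_autConj τ).autConj σ = hψ.autConj (σ * τ) := by
  have hodd : ∀ w, Odd (hψ.infinityType w) := fun w => hψ.odd hψ.hasInfinityType_infinityType w
  unfold IsConjugateSymplectic.autConj
  rw [autConj_congr σ _ _ (hasInfinityType_autConj τ hψ.hasInfinityType_infinityType hodd)
      (odd_autConjExp τ hψ.hasInfinityType_infinityType hodd)]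
  exact IdeleClassGroup.autConj_autConj σ τ hψ.hasInfinityType_infinityType hodd

/-- `1μ = μ` in the conjugate symplectic packaging. [cite: Liu2021, Cor. 4.20 (TeX ll. 2307–2314)] -/
theorem IsConjugateSymplectic.autConj_one (hψ : IsConjugateSymplectic L ψ) : hψ.autConj 1 = ψ :=
  IdeleClassGroup.autConj_one _ _

/-- **`σ⁻¹(σμ) = μ`**: every conjugate is conjugated back to `μ`, so "being `Aut(ℂ)`-conjugate" is symmetric and
`{σμ}` is the orbit THROUGH each of its members. [cite: Liu2021, Cor. 4.20 (TeX ll. 2307–2314)] -/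
theorem IsConjugateSymplectic.autConj_symm_autConj (hψ : IsConjugateSymplectic L ψ) (σ : ℂ ≃ₐ[ℚ] ℂ) :
    (hψ.isConjugateSymplectic_autConj σ).autConj σ.symm = ψ := by
  rw [hψ.autConj_autConj, ← AlgEquiv.aut_inv, inv_mul_cancel, hψ.autConj_one]

end GroupLaw

end IdeleClassGroup

end Literature.NumberTheory.Automorphic

end
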